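import Literature.MathematicalPhysics.QuantumFieldTheory.Balaban1983to89.B9B8KnitLetterPeriodic
import Literature.MathematicalPhysics.QuantumFieldTheory.Balaban1983to89.B8TorusPeriodization

/-!
# `Balaban1983to89.B9B8KnitLetterTransfer` — M5.9 ASSEMBLY, FILE A1: the TRANSFER MAPS between the consumer's carrier (`P`-periodic data on `ℤ^{d+1}`:
# site functions, LEVEL FAMILIES `ℕ → ℤ^{d+1} → 𝔸`, `XSpace` families) and def-Y's carrier (box chart `SiteY i`, BLOCKS `BlkY i`) at a constant-level
# member of the k-level family, their round trips at periodic arguments, and ★ THE TRANSPOSE DICTIONARY `Q′ᵀ`(knit) `=` `(L^{−(d+1)})ⁿ · Q′*`(def-Y)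

statement-level skeleton of published theorems with citation tags; proofs where landed; nothing here is a claim about the
Yang–Mills mass gap

T. Bałaban, *Propagators for lattice gauge theories in a background field*, Commun. Math. Phys. **99** (1985) 389–434
[`Balaban1985BackgroundPropagators`, "[B9]"]: (3.19) p. 393 (the `j`-fold covariant average `Q′_j(U)` and its adjoint), (3.21) p. 394, (3.24)–(3.25)
pp. 394–395 (`Δ′_a(U) = Δ_U + Σ_j a_j(Lʲη)⁻² Q′_j(U)*1_{Λ_j}Q′_j(U)`, `R = I − G′Q′*(Q′G′²Q′*)⁻¹Q′G′`).  T. Bałaban, *Spaces of regular gauge field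
configurations on a lattice and gauge fixing conditions*, Commun. Math. Phys. **99** (1985) 75–102 [`Balaban1985RegularSpaces`, "[B8]"]: p. 77 *«we admit
the case where some domains Ω_j are equal to T_η»* (the torus read `P`-periodically on `ℤᵈ`), (1.3)–(1.6) p. 77 (the `j`-th lattice of the torus of side
`P` has side `P∕Lʲ`), (1.29) p. 81 (`Q′ᵀ`).  T. Bałaban, *Propagators and renormalization transformations for lattice gauge theories. II*, Commun. Math.
Phys. **96** (1984) 223–250 [`Balaban1984PropagatorsII`, "[B6]"]: (2.1)–(2.4) p. 224 (the k-level family, its blocks `𝔅`), (2.16)–(2.17) p. 225, (2.69)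
p. 235 (the block pairing weight `(Lʲη)^{d+1}`).  STATUS: published, refereed.

CITATION HEADER (lean-in-tree rule).  Cell `lit-balaban`, seat `lit-balaban-t2s-1` (gen 4), MODULE M5.9 of the G-B9-LETTERS map of record
(`lit-balaban-r06/B9-LETTERS-MAP.md` §4: «assembly — `LettersAt` at a torus member from the [B9] objects»), file A1.  WHY THIS FILE.  The consumer of
sub-row G-B8-T2S — the v3 letter bundle `B8Thm2TorusLettersPer.LettersAtPer` behind the endpoint
`B8Thm2TorusAtOfLettersPerB9.thm2TorusAt_specialUnitary_of_lettersPerB9` — speaks the [B8]-knit's language: site functions on `ℤ^{d+1}` (`B7Prop1Explicit.Site`),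
LEVEL FAMILIES `μ : ℕ → ℤ^{d+1} → 𝔸` (a multiplier `μ_j` on every `j`-lattice; the letters `Qp n`, `QpT n`, `Aw n`, `Cinv n`), `XSpace` families
(`Fin (n+1) × ℤ^{d+1}`, the argument of `H′`), all `P`-PERIODIC (`P = 2L^{m+K}` the torus side; level `j`: period `P∕Lʲ`).  The [B9] objects of the junction
J-B (seat p33: `GpKnitY`, `QpY ∕ QpsY ∕ XinvY ∕ RY` at print's transporters `parKnitY`) live on def-Y's FINITE carriers: the box chart `SiteY i` of the
torus and the block set `BlkY i = 𝔅` of a member `i` of the k-level family.  J-A file 1 (`B9B8CarrierDictionary`: `liftFun`, `liftCfg`) and J-B files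
1–4a (`B9B8AveragingJunction.QpY_parKnitY_eq_QprimeIter`, `B9B8KnitLetterPeriodic.periodic_eq_at_chart`) transfer SITE functions; this file adds the
BLOCK ∕ LEVEL-FAMILY transfer and the one missing operator dictionary (the transpose `Q′ᵀ`), so that file A2 (`B8Thm2TorusLettersPerOfKnit`) can DEFINE the
seven letters of `LettersAtPer` from the J-B objects and prove their identity laws by rewriting.

WHAT THIS FILE PROVES (sorry-free; definitions with bodies = the transfer maps; everything else theorems; no estimate of [B8]∕[B9] is asserted).
* §1 `siteAt i x` — the chart of an ARBITRARY point `x ∈ ℤ^{d+1}` (`boxEquiv (0 + x)`); its coordinates are `x mod N₀` (`siteAt_val`), it is the identity on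
  the box (`siteAt_of_mem`) and `N₀`-periodic (`siteAt_add_period`).
* §2 the `ℂ`-linear SITE transfer `descL i f = f ∘ val` (restriction to the box) and `liftL i Φ = liftFun (Φ ∘ chart)` (periodic extension); `descL ∘ liftL = id`,
  `liftL ∘ descL = id` ON `N₀`-PERIODIC functions, `liftL` has periodic values.
* §3 the arithmetic of levels: `N₀ = Lⁿ·q_n` with `q_n = N₀ ∕ Lⁿ` the period of the `n`-lattice ([B8] (1.3)–(1.6)); `⌊(x mod Lⁿq)∕Lⁿ⌋ = ⌊x∕Lⁿ⌋ mod q`.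
* §4 the BLOCK transfer at a member of CONSTANT LEVEL `n` (`∀ z, j(z) = n`: the trivial domain sequence `Ω₁ = … = Ω_n = T_η` of sub-row G-B9-LETTERS):
  `blkAt i n y ∈ 𝔅` — the level-`n` block whose label is `y mod q_n` — with `blkAt_level`, ★ `blkAt_label`, ★ `blkAt_blk` (the block of a box point `z` is
  `blkAt n ⌊z∕Lⁿ⌋`), `blkAt_labelOf` (every block is `blkAt` of its label), `blkAt_add_period`; the `ℂ`-linear maps `descBL i μ = (s ↦ μ_{j_s}(y_s))`
  (a level family read on the blocks) and `liftBL i n ψ` (a block function extended `q_n`-periodically to the `n`-lattice, zero at other levels), with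
  `descBL ∘ liftBL n = id`, ★ `liftBL n (descBL μ) n = μ n` for level-periodic `μ`, `liftBL` level-periodic; `descXL i n X = (s ↦ X(n, y_s))` for `XSpace`
  families with ★ `descXL_blkAt`.
* §5 THE DICTIONARIES at a constant-level member: ★ `QprimeIter_liftL_eq_QpY_blkAt` — the knit's `Q′_n(U₀)` of a lifted box function, AT EVERY POINT of the
  `n`-lattice, is def-Y's `Q′(U; parKnitY)` at the block `blkAt n y` (p33's junction + periodicity); `descBL_QprimeIter_liftL` (block form);
  ★★ `QprimeT_liftBL_at_box` — the knit's TRANSPOSE `Q′_n(U₀)ᵀ` ([B9] (3.19)ᵀ, `B8Eq138LandauZd.QprimeT`) of a lifted block function at a box point IS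
  `(L^{−(d+1)})ⁿ ×` def-Y's `Q′*(U; parKnitY)` (`Node00.QpsY`: transposed kernel, inverted transporters) — the two carriers normalise the adjoint differently
  (the knit's `Q′ᵀ` is the plain transpose of a kernel with entries `L^{−(d+1)}` per step; def-Y's `Q′*` is the adjoint for the block pairing of weight
  `W_s = (L^{d+1})^{j_s}`, [B6] (2.69)); ★★★ `QT_liftBL` ∕ `QT_eq_liftL_QpsY` — the consumer's letter `QT L n (torusLam n) U₀` ((E4) `qpT_reads`) of a
  level-periodic family, AT EVERY `x ∈ ℤ^{d+1}`, is `(L^{−(d+1)})ⁿ · liftL (Q′*(U; parKnitY) (descBL μ))`.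

HONEST SCOPE.  Bookkeeping between two typings of ONE finite torus; constant-level members only (the torus case of [B8] Thm 2); the member constraints of
def-Y's carrier (`L = ℓ+1 ≥ 5` odd, `k ≥ 2`, `N₀ = Lᵏ·L·M_h·P′`) are those of `B6KLevelCensusIndexV1.KIdx` and are not relaxed here.  No estimate of [B8]∕[B9]
is proved or asserted; count-neutral; nothing continuum, nothing about OS axioms or the mass gap; `stub_PV3A` NOT discharged; the Yang–Mills mass gap is
NOT proved.  No `sorry`, no `axiom`, no `… : Prop` fact, no `instance`, no `notation`.  NEW file; nothing landed is modified.  Seat `lit-balaban-t2s-1`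
gen 4, 2026-08-28.
-/

noncomputable section

namespace Literature.MathematicalPhysics.QuantumFieldTheory.Balaban1983to89.B9B8KnitLetterTransfer

open B7Prop1Explicit renaming Site → LSite
open B7Prop1Explicit (e)
open Literature.MathematicalPhysics.QuantumLattice (blockMap)
open B7Eq78Linearization (conjR QprimeIter zdBlocking)
open B8Eq119TwistedAxial (bgT)
open B8Eq138LandauZd (QprimeT QT)
open B8Thm4TorusAt (torusLam)
open B8Eq1117Concrete (XSpace)
open B12Ineq417Flat (shiftCfg shiftCfg_apply)
open B10Eq27TorusAxialLog (transl transl_apply)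
open B8Thm2SetupTorus (transl_add_period)
open B9Eq39Adjoint (R)
open B4Reflection242 (boxDom mem_boxDom blk blk_mul)
open B6MultiLevelBoxOperator (N0)
open B6Geom246MultiLevelBox (bset blkOf blkOf_val blkOf_eq_iff_blk exists_blkOf_eq lev_eq_of_blkOf_eq scale_bounds corner corner_mem blkOf_corner)
open B6GlobalChartV1 (PV boxEquiv boxEquiv_apply toBox_apply)
open B6KLevelCensusIndexV1 (KIdx)
open B6Prop22KLevelTorusCensus (KTIdx)
open B8TorusPeriodization (pmod pmod_apply apply_pmod_of_per)
open B9B8CarrierDictionary (liftFun liftFun_apply liftFunL liftFunL_apply liftCfg liftCfg_periodic shiftCfg_liftFun liftFun_periodic)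
open B9B8AveragingJunction (parKnitY parOfT_blkCornerY boxEquiv_transl_of_mem liftFun_chart_apply blk_eq_blockMap blockMap_iterate
  QpY_parKnitY_eq_QprimeIter levY_of_blkOf)
open B9B8DeltaPrimeJunction (QprimeT_eq_compT QT_torusLam_eq)
open B9B8KnitLetterPeriodic (qLev period_eq_pow_mul periodic_eq_at_chart constLev_le QprimeIter_periodic QT_periodic)
open Node00

variable {d ℓ : ℕ} {hd : 1 ≤ d + 1} {hL : Odd (ℓ + 1) ∧ 1 < ℓ + 1} {b₀ b₁ : ℝ}

/-! ## §1 The chart of an arbitrary point of `ℤ^{d+1}` -/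

section Chart

variable (i : KIdx d ℓ hd hL b₀ b₁)

/-- **THE CHART OF A POINT OF `ℤ^{d+1}`**: `siteAt i x = chart(0 + x)`, the box site with the torus image of `x` (the knit reads `T_η` periodically on
`ℤ^{d+1}`, def-Y on the fundamental box). [cite: Balaban1985RegularSpaces, p.77 («Ω_j = T_η»); Balaban1984PropagatorsII, (2.1) p.224, dictionary] -/
def siteAt (x : LSite (d + 1)) : SiteY i := boxEquiv i.hN (transl (0 : Site (PV d ℓ i.m i.K hd hL) 0) x)

/-- the chart is `boxEquiv (0 + x)` (unfolding). [cite: Balaban1984PropagatorsII, (2.1) p.224, bookkeeping] -/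
theorem siteAt_eq (x : LSite (d + 1)) : siteAt i x = boxEquiv i.hN (transl (0 : Site (PV d ℓ i.m i.K hd hL) 0) x) := rfl

/-- ★ the coordinates of the chart are the coordinates of `x` reduced modulo the torus side `N₀`. [cite: Balaban1985RegularSpaces, p.77, (1.3) p.77; Balaban1984PropagatorsII, (2.1) p.224, dictionary] -/
theorem siteAt_val_apply (x : LSite (d + 1)) (μ : Fin (d + 1)) :
    (siteAt i x).1 μ = x μ % (((PV d ℓ i.m i.K hd hL).sitesPerDir 0 : ℕ) : ℤ) := by
  have hval : transl (0 : Site (PV d ℓ i.m i.K hd hL) 0) x μ = ((x μ : ℤ) : ZMod ((PV d ℓ i.m i.K hd hL).sitesPerDir 0)) := by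
    rw [transl_apply]; exact zero_add _
  rw [siteAt_eq, boxEquiv_apply, toBox_apply, hval, ZMod.val_intCast]

/-- the coordinates of the chart, as the coordinatewise reduction `pmod N₀`. [cite: Balaban1985RegularSpaces, p.77, dictionary] -/
theorem siteAt_val (x : LSite (d + 1)) : (siteAt i x).1 = pmod (((PV d ℓ i.m i.K hd hL).sitesPerDir 0 : ℕ) : ℤ) x :=
  funext fun μ => by rw [siteAt_val_apply, pmod_apply]

/-- ★ on the fundamental box the chart is the identity. [cite: Balaban1985RegularSpaces, p.77 («Ω_j = T_η»); Balaban1984PropagatorsII, (2.1) p.224, dictionary] -/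
theorem siteAt_of_mem (z : SiteY i) : siteAt i z.1 = z := boxEquiv_transl_of_mem i z.2

/-- ★ the chart is `N₀`-periodic in every direction. [cite: Balaban1985RegularSpaces, (1.3) p.77, p.77 («Ω_j = T_η»)] -/
theorem siteAt_add_period (x : LSite (d + 1)) (μ : Fin (d + 1)) :
    siteAt i (x + (((PV d ℓ i.m i.K hd hL).sitesPerDir 0 : ℕ) : ℤ) • e μ) = siteAt i x := by
  rw [siteAt_eq, siteAt_eq, transl_add_period]

end Chart

/-! ## §2 Site functions: restriction to the box and periodic extension, as `ℂ`-linear maps -/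

section SiteTransfer

variable {𝔸 : Type} [NormedRing 𝔸] [NormedAlgebra ℂ 𝔸] [CompleteSpace 𝔸]
variable (i : KIdx d ℓ hd hL b₀ b₁)

/-- **RESTRICTION TO THE BOX**: `(descL i f)(z) = f(z)` for a box site `z` — a `ℤ^{d+1}` site function read on def-Y's carrier.
[cite: Balaban1985RegularSpaces, p.77 («Ω_j = T_η»); Balaban1984PropagatorsII, (2.1) p.224, dictionary] -/
def descL : (LSite (d + 1) → 𝔸) →ₗ[ℂ] (SiteY i → 𝔸) := LinearMap.funLeft ℂ 𝔸 (Subtype.val : SiteY i → LSite (d + 1))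

omit [CompleteSpace 𝔸] in
/-- the restriction, evaluated. [cite: Balaban1985RegularSpaces, p.77, bookkeeping] -/
@[simp] theorem descL_apply (f : LSite (d + 1) → 𝔸) (z : SiteY i) : descL i f z = f z.1 := rfl

/-- **PERIODIC EXTENSION FROM THE BOX**: `liftL i Φ = liftFun (Φ ∘ chart)` — def-Y's box-chart function read `N₀`-periodically on `ℤ^{d+1}` (J-A's lift
composed with the chart). [cite: Balaban1985RegularSpaces, p.77 («Ω_j = T_η»), (1.3) p.77; Balaban1984PropagatorsII, (2.1) p.224, dictionary] -/
def liftL : (SiteY i → 𝔸) →ₗ[ℂ] (LSite (d + 1) → 𝔸) :=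
  liftFunL (PV d ℓ i.m i.K hd hL) ∘ₗ LinearMap.funLeft ℂ 𝔸 (⇑(boxEquiv i.hN) : Site (PV d ℓ i.m i.K hd hL) 0 → SiteY i)

omit [CompleteSpace 𝔸] in
/-- the extension is J-A's lift of `Φ ∘ chart`. [cite: Balaban1985RegularSpaces, p.77, bookkeeping] -/
theorem liftL_eq (Φ : SiteY i → 𝔸) : liftL i Φ = liftFun (Φ ∘ ⇑(boxEquiv i.hN)) := rfl

omit [CompleteSpace 𝔸] in
/-- the extension, evaluated: `(liftL Φ)(x) = Φ(siteAt x)`. [cite: Balaban1985RegularSpaces, p.77, bookkeeping] -/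
theorem liftL_apply (Φ : SiteY i → 𝔸) (x : LSite (d + 1)) : liftL i Φ x = Φ (siteAt i x) := rfl

omit [CompleteSpace 𝔸] in
/-- ★ restriction ∘ extension = identity: a box function is recovered from its periodic extension. [cite: Balaban1985RegularSpaces, p.77 («Ω_j = T_η»), dictionary] -/
theorem descL_liftL (Φ : SiteY i → 𝔸) : descL i (liftL i Φ) = Φ :=
  funext fun z => liftFun_chart_apply i Φ z

omit [CompleteSpace 𝔸] in
/-- the same, evaluated. [cite: Balaban1985RegularSpaces, p.77, bookkeeping] -/
theorem liftL_apply_val (Φ : SiteY i → 𝔸) (z : SiteY i) : liftL i Φ z.1 = Φ z := liftFun_chart_apply i Φ z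

omit [CompleteSpace 𝔸] in
/-- ★ extension ∘ restriction = identity ON `N₀`-PERIODIC functions: a periodic `ℤ^{d+1}` function is read off the box.
[cite: Balaban1985RegularSpaces, (1.3) p.77, p.77 («Ω_j = T_η»); Balaban1984PropagatorsII, (2.1) p.224, dictionary] -/
theorem liftL_descL {f : LSite (d + 1) → 𝔸}
    (hf : ∀ (x : LSite (d + 1)) (μ : Fin (d + 1)), f (x + (((PV d ℓ i.m i.K hd hL).sitesPerDir 0 : ℕ) : ℤ) • e μ) = f x) :
    liftL i (descL i f) = f :=
  funext fun x => (periodic_eq_at_chart i hf x).symm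

omit [CompleteSpace 𝔸] in
/-- ★ the extension has `N₀`-periodic values, for EVERY box function. [cite: Balaban1985RegularSpaces, (1.3) p.77, p.77 («Ω_j = T_η»)] -/
theorem liftL_add_period (Φ : SiteY i → 𝔸) (x : LSite (d + 1)) (μ : Fin (d + 1)) :
    liftL i Φ (x + (((PV d ℓ i.m i.K hd hL).sitesPerDir 0 : ℕ) : ℤ) • e μ) = liftL i Φ x :=
  liftFun_periodic (P := PV d ℓ i.m i.K hd hL) (Φ ∘ ⇑(boxEquiv i.hN)) x μ

omit [CompleteSpace 𝔸] in
/-- the extension is periodic, `shiftCfg` form (the hypothesis shape of `B9B8KnitLetterPeriodic`). [cite: Balaban1985RegularSpaces, (1.3) p.77] -/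
theorem shiftCfg_liftL (Φ : SiteY i → 𝔸) (μ : Fin (d + 1)) :
    shiftCfg ((((PV d ℓ i.m i.K hd hL).sitesPerDir 0 : ℕ) : ℤ) • e μ) (liftL i Φ) = liftL i Φ :=
  shiftCfg_liftFun (P := PV d ℓ i.m i.K hd hL) (Φ ∘ ⇑(boxEquiv i.hN)) μ

omit [CompleteSpace 𝔸] in
/-- two box functions with the same extension are equal. [cite: Balaban1985RegularSpaces, p.77, bookkeeping] -/
theorem liftL_injective : Function.Injective (liftL (𝔸 := 𝔸) i) := fun Φ Ψ h => by
  rw [← descL_liftL i Φ, ← descL_liftL i Ψ, h]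

end SiteTransfer

/-! ## §3 Level arithmetic: `N₀ = Lⁿ·q_n`, `⌊(x mod Lⁿq)∕Lⁿ⌋ = ⌊x∕Lⁿ⌋ mod q` -/

section Arithmetic

variable (i : KIdx d ℓ hd hL b₀ b₁)

/-- ★ the period of the `n`-lattice as an integer quotient: `N₀ ∕ Lⁿ = q_n` (`n ≤ k`; exact division). [cite: Balaban1985RegularSpaces, (1.3)–(1.6) p.77; Balaban1984PropagatorsII, (2.1) p.224, dictionary] -/
theorem period_div_pow {n : ℕ} (hn : n ≤ i.k) (μ : Fin (d + 1)) :
    (((PV d ℓ i.m i.K hd hL).sitesPerDir 0 : ℕ) : ℤ) / (((ℓ + 1 : ℕ) : ℤ)) ^ n = ((qLev i n μ : ℕ) : ℤ) := by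
  have hL0 : (((ℓ + 1 : ℕ) : ℤ)) ^ n ≠ 0 := pow_ne_zero _ (by positivity)
  rw [period_eq_pow_mul i hn μ, Nat.cast_mul, Nat.cast_pow, mul_comm, Int.mul_ediv_cancel _ hL0]

/-- ★ `Lⁿ · (N₀ ∕ Lⁿ) = N₀` (`n ≤ k`). [cite: Balaban1985RegularSpaces, (1.3)–(1.6) p.77; Balaban1984PropagatorsII, (2.1) p.224, dictionary] -/
theorem pow_mul_period_div {n : ℕ} (hn : n ≤ i.k) (μ : Fin (d + 1)) :
    (((ℓ + 1 : ℕ) : ℤ)) ^ n * ((((PV d ℓ i.m i.K hd hL).sitesPerDir 0 : ℕ) : ℤ) / (((ℓ + 1 : ℕ) : ℤ)) ^ n)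
      = (((PV d ℓ i.m i.K hd hL).sitesPerDir 0 : ℕ) : ℤ) := by
  rw [period_div_pow i hn μ, period_eq_pow_mul i hn μ, Nat.cast_mul, Nat.cast_pow]

/-- the same with the cast of the natural power `((Lⁿ : ℕ) : ℤ)` (the form of block corners `cornerY`, `blk_mul`). [cite: Balaban1984PropagatorsII, (2.1) p.224, bookkeeping] -/
theorem castPow_mul_period_div {n : ℕ} (hn : n ≤ i.k) :
    ((((ℓ + 1) ^ n : ℕ)) : ℤ) * ((((PV d ℓ i.m i.K hd hL).sitesPerDir 0 : ℕ) : ℤ) / (((ℓ + 1 : ℕ) : ℤ)) ^ n)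
      = (((PV d ℓ i.m i.K hd hL).sitesPerDir 0 : ℕ) : ℤ) := by
  rw [Nat.cast_pow, pow_mul_period_div i hn 0]

/-- the integer identity behind the block label of a reduced point: `(x mod bq) ∕ b = (x ∕ b) mod q` for `b > 0` (floor division and non-negative remainder).
[folklore] -/
private theorem emod_mul_ediv (x : ℤ) {b : ℤ} (hb : 0 < b) (q : ℤ) : x % (b * q) / b = x / b % q := by
  have h1 : x % (b * q) = x + b * (-(q * (x / (b * q)))) := by rw [Int.emod_def]; ring
  rw [h1, Int.add_mul_ediv_left _ _ hb.ne', Int.emod_def (x / b) q, Int.ediv_ediv_of_nonneg hb.le]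
  ring

/-- ★ THE LABEL OF A REDUCED POINT: `⌊(x mod N)∕b⌋ = ⌊x∕b⌋ mod q` coordinatewise, for `N = b·q` — reducing a fine point modulo the torus side reduces its
`b`-block label modulo the side of the block lattice. [cite: Balaban1985RegularSpaces, (1.3)–(1.6) p.77; Balaban1984PropagatorsII, (2.1) p.224, dictionary] -/
theorem blk_pmod_of_mul_eq {b : ℕ} (hb : 1 ≤ b) {q N : ℤ} (hN : (b : ℤ) * q = N) (x : Fin (d + 1) → ℤ) :
    blk b (pmod N x) = pmod q (blk b x) := by
  subst hN
  funext μ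
  simp only [blk, pmod_apply]
  exact emod_mul_ediv (x μ) (by exact_mod_cast hb) q

/-- the `b`-block label of `b·y` is `y` (scalar-multiple form of `B4Reflection242.blk_mul`). [cite: Balaban1984PropagatorsII, (2.1) p.224, bookkeeping] -/
theorem blk_zsmul {b : ℕ} (hb : 1 ≤ b) (y : Fin (d + 1) → ℤ) : blk b (((b : ℕ) : ℤ) • y) = y :=
  blk_mul hb y

end Arithmetic

/-! ## §4 Blocks at a constant-level member: `blkAt`, the block transfer `descBL` ∕ `liftBL`, the `XSpace` reading `descXL` -/

section BlockTransfer

variable (i : KIdx d ℓ hd hL b₀ b₁)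

/-- **THE LEVEL-`n` BLOCK WITH LABEL `y mod q_n`**: the block of `𝔅` containing the chart of the fine point `Lⁿ·y` (at a member of constant level `n`
every such block has level `n`; the label lattice of level `n` has period `q_n = N₀∕Lⁿ`, [B8] (1.3)–(1.6)).
[cite: Balaban1984PropagatorsII, (2.1)–(2.4) p.224, (2.45) p.231; Balaban1985RegularSpaces, (1.3)–(1.6) p.77, dictionary] -/
def blkAt (n : ℕ) (y : LSite (d + 1)) : BlkY i := blkOf i.D.toDomains (siteAt i ((((ℓ + 1) ^ n : ℕ) : ℤ) • y))

/-- unfolding. [cite: Balaban1984PropagatorsII, (2.1) p.224, bookkeeping] -/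
theorem blkAt_eq (n : ℕ) (y : LSite (d + 1)) : blkAt i n y = blkOf i.D.toDomains (siteAt i ((((ℓ + 1) ^ n : ℕ) : ℤ) • y)) := rfl

/-- ★ `blkAt` is `q_n`-periodic in the label: `blkAt n (y + (N₀∕Lⁿ)•e_μ) = blkAt n y` (`n ≤ k`). [cite: Balaban1985RegularSpaces, (1.3)–(1.6) p.77, p.77 («Ω_j = T_η»); Balaban1984PropagatorsII, (2.1) p.224] -/
theorem blkAt_add_period {n : ℕ} (hn : n ≤ i.k) (y : LSite (d + 1)) (μ : Fin (d + 1)) :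
    blkAt i n (y + ((((PV d ℓ i.m i.K hd hL).sitesPerDir 0 : ℕ) : ℤ) / (((ℓ + 1 : ℕ) : ℤ)) ^ n) • e μ) = blkAt i n y := by
  have hpt : (((ℓ + 1) ^ n : ℕ) : ℤ) • (y + ((((PV d ℓ i.m i.K hd hL).sitesPerDir 0 : ℕ) : ℤ) / (((ℓ + 1 : ℕ) : ℤ)) ^ n) • e μ)
      = (((ℓ + 1) ^ n : ℕ) : ℤ) • y + (((PV d ℓ i.m i.K hd hL).sitesPerDir 0 : ℕ) : ℤ) • e μ := by
    rw [smul_add, smul_smul, castPow_mul_period_div i hn]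
  rw [blkAt_eq, blkAt_eq, hpt, siteAt_add_period]

variable {n : ℕ}

/-- at a constant-level member every block has level `n`. [cite: Balaban1984PropagatorsII, (2.3)–(2.4) p.224; Balaban1985RegularSpaces, p.77 («Ω_j = T_η»)] -/
theorem blk_level (hlev : ∀ z : SiteY i, levY i z = n) (s : BlkY i) : s.1.1 = n := by
  obtain ⟨z, hz⟩ := exists_blkOf_eq i.D.toDomains s
  rw [← levY_of_blkOf i hz, hlev]

/-- ★ the level of `blkAt n y` is `n`. [cite: Balaban1984PropagatorsII, (2.3)–(2.4) p.224, bookkeeping] -/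
theorem blkAt_level (hlev : ∀ z : SiteY i, levY i z = n) (y : LSite (d + 1)) : (blkAt i n y).1.1 = n := blk_level i hlev _

/-- ★★ THE LABEL OF `blkAt n y` IS `y mod q_n` (`q_n = N₀∕Lⁿ`). [cite: Balaban1985RegularSpaces, (1.3)–(1.6) p.77; Balaban1984PropagatorsII, (2.1) p.224, dictionary] -/
theorem blkAt_label (hlev : ∀ z : SiteY i, levY i z = n) (y : LSite (d + 1)) :
    (blkAt i n y).1.2 = pmod ((((PV d ℓ i.m i.K hd hL).sitesPerDir 0 : ℕ) : ℤ) / (((ℓ + 1 : ℕ) : ℤ)) ^ n) y := by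
  have hn : n ≤ i.k := constLev_le i hlev
  have hb : 1 ≤ (ℓ + 1) ^ n := Nat.one_le_pow _ _ (Nat.succ_pos ℓ)
  have hs : (blkAt i n y).1.1 = n := blkAt_level i hlev y
  have hlab : blk ((ℓ + 1) ^ (blkAt i n y).1.1) (siteAt i ((((ℓ + 1) ^ n : ℕ) : ℤ) • y)).1 = (blkAt i n y).1.2 :=
    (blkOf_eq_iff_blk i.D.toDomains).1 rfl
  rw [hs, siteAt_val, blk_pmod_of_mul_eq hb (castPow_mul_period_div i hn), blk_zsmul hb] at hlab
  exact hlab.symm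

/-- ★★ THE BLOCK OF A BOX POINT `z` IS `blkAt n ⌊z∕Lⁿ⌋` (constant level `n`). [cite: Balaban1984PropagatorsII, (2.1)–(2.4) p.224, (2.45) p.231, dictionary] -/
theorem blkAt_blk (hlev : ∀ z : SiteY i, levY i z = n) (z : SiteY i) : blkAt i n (blk ((ℓ + 1) ^ n) z.1) = blkOf i.D.toDomains z := by
  have hcorner : (((ℓ + 1) ^ n : ℕ) : ℤ) • blk ((ℓ + 1) ^ n) z.1 = (cornerY i n z).1 := by
    funext μ; rw [cornerY_apply, Pi.smul_apply, smul_eq_mul]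
  have hmem : (((ℓ + 1) ^ n : ℕ) : ℤ) • blk ((ℓ + 1) ^ n) z.1 ∈ (toKT i).XB := by rw [hcorner]; exact (cornerY i n z).2
  rw [blkAt_eq, siteAt_eq, boxEquiv_transl_of_mem i hmem]
  apply (blkOf_eq_iff_blk i.D.toDomains).2
  have hl : (blkOf i.D.toDomains z).1.1 = n := blk_level i hlev _
  have hlab : blk ((ℓ + 1) ^ n) z.1 = (blkOf i.D.toDomains z).1.2 := by
    have h := (blkOf_eq_iff_blk i.D.toDomains).1 (rfl : blkOf i.D.toDomains z = blkOf i.D.toDomains z)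
    rwa [hl] at h
  rw [hl, ← hlab]
  exact blk_zsmul (Nat.one_le_pow _ _ (Nat.succ_pos ℓ)) _

/-- ★ EVERY BLOCK IS `blkAt n` OF ITS LABEL (constant level `n`). [cite: Balaban1984PropagatorsII, (2.1)–(2.4) p.224, (2.45) p.231, dictionary] -/
theorem blkAt_labelOf (hlev : ∀ z : SiteY i, levY i z = n) (s : BlkY i) : blkAt i n s.1.2 = s := by
  have hs : s.1.1 = n := blk_level i hlev s
  have hcorner : blk ((ℓ + 1) ^ n) (blkCornerY i s).1 = s.1.2 := by
    have h := B9B8AveragingJunction.blk_blkCornerY i s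
    rwa [hs] at h
  rw [← hcorner, blkAt_blk i hlev]
  exact blkOf_corner i.D.toDomains s

variable {𝔸 : Type} [NormedRing 𝔸] [NormedAlgebra ℂ 𝔸] [CompleteSpace 𝔸]

/-- **A LEVEL FAMILY READ ON THE BLOCKS**: `(descBL μ)(s) = μ_{j_s}(y_s)` — the multiplier of the block's level at the block's label.
[cite: Balaban1985RegularSpaces, (1.29) p.81 (multipliers on `𝔅_k = ⋃_j Λ_j`); Balaban1984PropagatorsII, (2.45) p.231, dictionary] -/
def descBL : (ℕ → LSite (d + 1) → 𝔸) →ₗ[ℂ] (BlkY i → 𝔸) where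
  toFun μ := fun s => μ s.1.1 s.1.2
  map_add' _ _ := rfl
  map_smul' _ _ := rfl

omit [CompleteSpace 𝔸] in
/-- the block reading, evaluated. [cite: Balaban1985RegularSpaces, (1.29) p.81, bookkeeping] -/
@[simp] theorem descBL_apply (μ : ℕ → LSite (d + 1) → 𝔸) (s : BlkY i) : descBL i μ s = μ s.1.1 s.1.2 := rfl

/-- **A BLOCK FUNCTION EXTENDED TO A LEVEL FAMILY** at the member's level `n`: `q_n`-periodically on the `n`-lattice (`y ↦ ψ(blkAt n y)`), zero at the
other levels (the torus member has constraint sites at its top level only, `B8Thm4TorusAt.torusLam`). [cite: Balaban1985RegularSpaces, (1.5)–(1.6) p.77, (1.29) p.81, p.77 («Ω_j = T_η»); Balaban1984PropagatorsII, (2.45) p.231, dictionary] -/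
def liftBL (n : ℕ) : (BlkY i → 𝔸) →ₗ[ℂ] (ℕ → LSite (d + 1) → 𝔸) where
  toFun ψ := fun j y => if j = n then ψ (blkAt i n y) else 0
  map_add' ψ ψ' := by
    funext j y
    simp only [Pi.add_apply]
    split_ifs <;> simp
  map_smul' c ψ := by
    funext j y
    simp only [Pi.smul_apply, RingHom.id_apply]
    split_ifs <;> simp

omit [CompleteSpace 𝔸] in
/-- the extension at the member's level. [cite: Balaban1985RegularSpaces, (1.29) p.81, bookkeeping] -/
@[simp] theorem liftBL_self (ψ : BlkY i → 𝔸) (y : LSite (d + 1)) : liftBL i n ψ n y = ψ (blkAt i n y) := by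
  show (if n = n then ψ (blkAt i n y) else 0) = _
  rw [if_pos rfl]

omit [CompleteSpace 𝔸] in
/-- the extension vanishes at the other levels. [cite: Balaban1985RegularSpaces, (1.5)–(1.6) p.77, bookkeeping] -/
theorem liftBL_of_ne (ψ : BlkY i → 𝔸) {j : ℕ} (hj : j ≠ n) : liftBL i n ψ j = 0 := by
  funext y
  show (if j = n then ψ (blkAt i n y) else 0) = 0
  rw [if_neg hj]

omit [CompleteSpace 𝔸] in
/-- ★ THE EXTENSION IS LEVEL-PERIODIC (period `N₀∕Lʲ` at level `j`, the hypothesis shape of `B8Thm2TorusLettersPer.LettersAtPer`), for EVERY block function.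
[cite: Balaban1985RegularSpaces, (1.3)–(1.6) p.77, p.77 («Ω_j = T_η»)] -/
theorem liftBL_add_period (hlev : ∀ z : SiteY i, levY i z = n) (ψ : BlkY i → 𝔸) (j : ℕ) (y : LSite (d + 1)) (μ : Fin (d + 1)) :
    liftBL i n ψ j (y + ((((PV d ℓ i.m i.K hd hL).sitesPerDir 0 : ℕ) : ℤ) / (((ℓ + 1 : ℕ) : ℤ)) ^ j) • e μ) = liftBL i n ψ j y := by
  by_cases hj : j = n
  · subst hj
    rw [liftBL_self, liftBL_self, blkAt_add_period i (constLev_le i hlev)]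
  · rw [liftBL_of_ne i ψ hj, Pi.zero_apply, Pi.zero_apply]

omit [CompleteSpace 𝔸] in
/-- the same, `shiftCfg` form with the period `qLev` of `B9B8KnitLetterPeriodic`. [cite: Balaban1985RegularSpaces, (1.3)–(1.6) p.77, bookkeeping] -/
theorem shiftCfg_liftBL_self (hlev : ∀ z : SiteY i, levY i z = n) (ψ : BlkY i → 𝔸) (μ : Fin (d + 1)) :
    shiftCfg (((qLev i n μ : ℕ) : ℤ) • e μ) (liftBL i n ψ n) = liftBL i n ψ n := by
  funext y
  rw [shiftCfg_apply, ← period_div_pow i (constLev_le i hlev) μ, liftBL_add_period i hlev]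

omit [CompleteSpace 𝔸] in
/-- ★ reading ∘ extension = identity on block functions. [cite: Balaban1985RegularSpaces, (1.29) p.81; Balaban1984PropagatorsII, (2.45) p.231, dictionary] -/
theorem descBL_liftBL (hlev : ∀ z : SiteY i, levY i z = n) (ψ : BlkY i → 𝔸) : descBL i (liftBL i n ψ) = ψ := by
  funext s
  have hs : s.1.1 = n := blk_level i hlev s
  rw [descBL_apply, hs, liftBL_self, blkAt_labelOf i hlev]

omit [CompleteSpace 𝔸] in
/-- ★★ extension ∘ reading = identity AT THE MEMBER's LEVEL on LEVEL-PERIODIC families: `liftBL n (descBL μ) n = μ n` whenever `μ_n` is `q_n`-periodic.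
[cite: Balaban1985RegularSpaces, (1.3)–(1.6) p.77, (1.29) p.81, p.77 («Ω_j = T_η»); Balaban1984PropagatorsII, (2.45) p.231, dictionary] -/
theorem liftBL_descBL_self (hlev : ∀ z : SiteY i, levY i z = n) {μ : ℕ → LSite (d + 1) → 𝔸}
    (hμ : ∀ (y : LSite (d + 1)) (ν : Fin (d + 1)), μ n (y + ((((PV d ℓ i.m i.K hd hL).sitesPerDir 0 : ℕ) : ℤ) / (((ℓ + 1 : ℕ) : ℤ)) ^ n) • e ν) = μ n y) :
    liftBL i n (descBL i μ) n = μ n := by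
  funext y
  rw [liftBL_self, descBL_apply, blkAt_level i hlev, blkAt_label i hlev]
  exact apply_pmod_of_per hμ y

/-- **AN `XSpace` FAMILY READ ON THE BLOCKS** at the member's level: `(descXL n X)(s) = X(n, y_s)` (the argument of the consumer's `H′`, a bounded family on
`Fin (n+1) × ℤ^{d+1}`, read at the top level on the block labels). [cite: Balaban1985RegularSpaces, (1.91)–(1.92) p.91; Balaban1984PropagatorsII, (2.45) p.231, dictionary] -/
def descXL (n : ℕ) : XSpace (d := d + 1) n 𝔸 →ₗ[ℂ] (BlkY i → 𝔸) where
  toFun X := fun s => X (Fin.last n, s.1.2)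
  map_add' _ _ := rfl
  map_smul' _ _ := rfl

omit [CompleteSpace 𝔸] in
/-- the `XSpace` reading, evaluated. [cite: Balaban1985RegularSpaces, (1.91) p.91, bookkeeping] -/
@[simp] theorem descXL_apply (X : XSpace (d := d + 1) n 𝔸) (s : BlkY i) : descXL i n X s = X (Fin.last n, s.1.2) := rfl

omit [CompleteSpace 𝔸] in
/-- ★ the `XSpace` reading at `blkAt n y` of a LEVEL-PERIODIC family is `X(n, y)`. [cite: Balaban1985RegularSpaces, (1.91)–(1.92) p.91, (1.3)–(1.6) p.77, dictionary] -/
theorem descXL_blkAt (hlev : ∀ z : SiteY i, levY i z = n) {X : XSpace (d := d + 1) n 𝔸}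
    (hX : ∀ (p : Fin (n + 1) × LSite (d + 1)) (ν : Fin (d + 1)),
      X (p.1, p.2 + ((((PV d ℓ i.m i.K hd hL).sitesPerDir 0 : ℕ) : ℤ) / (((ℓ + 1 : ℕ) : ℤ)) ^ (p.1 : ℕ)) • e ν) = X p) (y : LSite (d + 1)) :
    descXL i n X (blkAt i n y) = X (Fin.last n, y) := by
  rw [descXL_apply, blkAt_label i hlev]
  have hX' : ∀ (z : LSite (d + 1)) (ν : Fin (d + 1)),
      (fun w => X (Fin.last n, w)) (z + ((((PV d ℓ i.m i.K hd hL).sitesPerDir 0 : ℕ) : ℤ) / (((ℓ + 1 : ℕ) : ℤ)) ^ n) • e ν) = (fun w => X (Fin.last n, w)) z :=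
    fun z ν => by simpa using hX (Fin.last n, z) ν
  exact apply_pmod_of_per (P := (((PV d ℓ i.m i.K hd hL).sitesPerDir 0 : ℕ) : ℤ) / (((ℓ + 1 : ℕ) : ℤ)) ^ n)
    (f := fun w => X (Fin.last n, w)) hX' y

end BlockTransfer

/-! ## §5 The dictionaries at a constant-level member: `Q′_n` everywhere, and the transpose `Q′ᵀ` ↔ `Q′*` -/

section Dictionaries

variable {𝔸 : Type} [NormedRing 𝔸] [NormedAlgebra ℂ 𝔸] [CompleteSpace 𝔸]
variable (i : KIdx d ℓ hd hL b₀ b₁) {n : ℕ}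

/-- the forward junction of J-B file 1, BLOCK FORM: the level family `(j, y) ↦ (Q′_j(U₀) liftL Φ)(y)` read on the blocks IS def-Y's `Q′(U; parKnitY)Φ` (any member).
[cite: Balaban1985BackgroundPropagators, (3.19) p.393, (3.21) p.394; Balaban1985RegularSpaces, (1.29) p.81] -/
theorem descBL_QprimeIter_liftL (U : CfgY 𝔸 i) (Φ : SiteY i → 𝔸) :
    descBL i (fun j y => QprimeIter (zdBlocking (d + 1) (ℓ + 1)) (bgT (ℓ + 1) (liftCfg U)) j (liftL i Φ) y) = QpY i (parKnitY i) U Φ :=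
  funext fun s => (QpY_parKnitY_eq_QprimeIter i U Φ s).symm

/-- the same with the torus member's constraint-set indicator (the consumer's `Qp n` shape: `(torusLam n j).indicator (Q′_j g)`), constant level `n`.
[cite: Balaban1985RegularSpaces, (1.5)–(1.6) p.77, (1.29) p.81; Balaban1985BackgroundPropagators, (3.19) p.393] -/
theorem descBL_indicator_QprimeIter_liftL (hlev : ∀ z : SiteY i, levY i z = n) (U : CfgY 𝔸 i) (Φ : SiteY i → 𝔸) :
    descBL i (fun j => (torusLam (d := d + 1) n j).indicator (QprimeIter (zdBlocking (d + 1) (ℓ + 1)) (bgT (ℓ + 1) (liftCfg U)) j (liftL i Φ)))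
      = QpY i (parKnitY i) U Φ := by
  funext s
  have hs : s.1.1 = n := blk_level i hlev s
  rw [descBL_apply, hs, B8Thm4TorusAt.torusLam_self, Set.indicator_univ, QpY_parKnitY_eq_QprimeIter, hs, liftL_eq]

/-- ★★ **THE KNIT's `Q′_n(U₀)` OF A LIFTED BOX FUNCTION, AT EVERY POINT OF THE `n`-LATTICE, IS def-Y's `Q′(U; parKnitY)` AT THE BLOCK `blkAt n y`** (constant
level `n`): J-B file 1's junction at the block labels, extended by the `q_n`-periodicity of `Q′_n(U₀)g` for periodic `g` (`B9B8KnitLetterPeriodic.QprimeIter_periodic`).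
[cite: Balaban1985BackgroundPropagators, (3.19) p.393, (3.21) p.394; Balaban1985RegularSpaces, (1.29) p.81, (1.3)–(1.6) p.77, p.77 («Ω_j = T_η»)] -/
theorem QprimeIter_liftL_eq_QpY_blkAt (hlev : ∀ z : SiteY i, levY i z = n) (U : CfgY 𝔸 i) (Φ : SiteY i → 𝔸) (y : LSite (d + 1)) :
    QprimeIter (zdBlocking (d + 1) (ℓ + 1)) (bgT (ℓ + 1) (liftCfg U)) n (liftL i Φ) y = QpY i (parKnitY i) U Φ (blkAt i n y) := by
  have hn : n ≤ i.k := constLev_le i hlev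
  have hper : ∀ (w : LSite (d + 1)) (ν : Fin (d + 1)),
      QprimeIter (zdBlocking (d + 1) (ℓ + 1)) (bgT (ℓ + 1) (liftCfg U)) n (liftL i Φ)
          (w + ((((PV d ℓ i.m i.K hd hL).sitesPerDir 0 : ℕ) : ℤ) / (((ℓ + 1 : ℕ) : ℤ)) ^ n) • e ν)
        = QprimeIter (zdBlocking (d + 1) (ℓ + 1)) (bgT (ℓ + 1) (liftCfg U)) n (liftL i Φ) w := fun w ν => by
    rw [period_div_pow i hn ν]
    exact QprimeIter_periodic i U (shiftCfg_liftL i Φ) hn w ν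
  rw [QpY_parKnitY_eq_QprimeIter, blkAt_level i hlev, blkAt_label i hlev, ← liftL_eq]
  exact (apply_pmod_of_per hper y).symm

omit [CompleteSpace 𝔸] in
/-- the entries of def-Y's `Q′*`-kernel: `q′*(z, s) = [z ∈ s]`. [cite: Balaban1984PropagatorsII, (2.16)–(2.17) p.225; Balaban1985BackgroundPropagators, (3.24)–(3.25) pp.394–395, bookkeeping] -/
theorem qpsK_apply (z : SiteY i) (s : BlkY i) : qpsK i z s = if blkOf i.D.toDomains z = s then 1 else 0 := rfl

/-- ★★ **THE TRANSPOSE DICTIONARY AT A BOX POINT.**  On a constant-level member, for every background `U`, block function `ψ` and box site `z`: the knit's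
`Q′_n(U₀)ᵀ` ((3.19)ᵀ second form, `B9B8DeltaPrimeJunction.QprimeT_eq_compT`: ONE kernel entry `(L^{−(d+1)})ⁿ R(T^{(n)}(y,z))⁻¹`) of the periodic extension
`liftBL n ψ n`, read at `z`, IS `(L^{−(d+1)})ⁿ ×` def-Y's `Q′*(U; parKnitY)ψ` at `z` (`Node00.QpsY`: kernel `[z ∈ s]`, transporter `U(Γ_{c_s,z})⁻¹ = T^{(n)}(y_s, z)⁻¹` by
`B9B8AveragingJunction.parOfT_blkCornerY`). [cite: Balaban1985BackgroundPropagators, (3.19) p.393, (3.24)–(3.25) pp.394–395; Balaban1985RegularSpaces, (1.29) p.81; Balaban1984PropagatorsII, (2.16)–(2.17) p.225, (2.69) p.235] -/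
theorem QprimeT_liftBL_at_box (hlev : ∀ z : SiteY i, levY i z = n) (U : CfgY 𝔸 i) (ψ : BlkY i → 𝔸) (z : SiteY i) :
    QprimeT (ℓ + 1) (liftCfg U) n (liftBL i n ψ n) z.1 = (((((ℓ + 1 : ℕ) : ℝ)) ^ (d + 1))⁻¹) ^ n • QpsY i (parKnitY i) U ψ z := by
  set s : BlkY i := blkOf i.D.toDomains z with hsdef
  have hzs : blkOf i.D.toDomains z = s := rfl
  have hs : s.1.1 = n := blk_level i hlev s
  have hlab : blk ((ℓ + 1) ^ n) z.1 = s.1.2 := by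
    have h := (blkOf_eq_iff_blk i.D.toDomains).1 hzs
    rwa [hs] at h
  -- the knit side: one kernel entry at the ancestor `y = blk (Lⁿ) z`
  have hanc : (blockMap (ℓ + 1))^[n] z.1 = blk ((ℓ + 1) ^ n) z.1 := by rw [blockMap_iterate, blk_eq_blockMap]
  have hT : B9B8AveragingKernelZd.compT (ℓ + 1) (bgT (ℓ + 1) (liftCfg U)) n (blk ((ℓ + 1) ^ n) z.1) z.1 = parKnitY i U (blkCornerY i s) z := by
    rw [hlab, ← hs]
    exact (parOfT_blkCornerY i (bgT (ℓ + 1) (liftCfg U)) hzs).symm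
  rw [QprimeT_eq_compT, hanc, liftBL_self, blkAt_blk i hlev, hT]
  -- def-Y's side: the `Q′*` sum has one term, `s = blkOf z`
  rw [QpsY, trLiftY_apply, Finset.sum_eq_single s]
  · rw [qpsK_apply, if_pos hzs, Complex.ofReal_one, one_smul]
    rfl
  · intro s' _ hs'
    rw [qpsK_apply, if_neg (fun h => hs' (h.symm.trans hzs)), Complex.ofReal_zero, zero_smul]
  · intro h; exact absurd (Finset.mem_univ s) h

/-- ★★★ **THE CONSUMER's `Q′ᵀ`-LETTER OF A LIFTED BLOCK FUNCTION, EVERYWHERE**: on a constant-level member, for every `U`, block function `ψ` and EVERY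
`x ∈ ℤ^{d+1}`, `QT L n (torusLam n) U₀ (liftBL n ψ) (x) = (L^{−(d+1)})ⁿ · liftL (Q′*(U; parKnitY) ψ) (x)`, `U₀ = liftCfg U` — the letter pinned by (E4)
`qpT_reads` of `B8Thm2TorusLettersPer.LettersAtPer`, read on def-Y's carrier (both sides are `N₀`-periodic; at box points it is `QprimeT_liftBL_at_box`).
[cite: Balaban1985RegularSpaces, (1.29) p.81, (1.5)–(1.6) p.77, p.77 («Ω_j = T_η»); Balaban1985BackgroundPropagators, (3.19) p.393, (3.24)–(3.25) pp.394–395] -/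
theorem QT_liftBL (hlev : ∀ z : SiteY i, levY i z = n) (U : CfgY 𝔸 i) (ψ : BlkY i → 𝔸) (x : LSite (d + 1)) :
    QT (ℓ + 1) n (torusLam n) (liftCfg U) (liftBL i n ψ) x
      = (((((ℓ + 1 : ℕ) : ℝ)) ^ (d + 1))⁻¹) ^ n • liftL i (QpsY i (parKnitY i) U ψ) x := by
  have hn : n ≤ i.k := constLev_le i hlev
  -- both sides are `N₀`-periodic; compare at the chart of `x`
  have hperL : ∀ (w : LSite (d + 1)) (μ : Fin (d + 1)),
      QT (ℓ + 1) n (torusLam n) (liftCfg U) (liftBL i n ψ) (w + (((PV d ℓ i.m i.K hd hL).sitesPerDir 0 : ℕ) : ℤ) • e μ)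
        = QT (ℓ + 1) n (torusLam n) (liftCfg U) (liftBL i n ψ) w :=
    fun w μ => QT_periodic i U hn μ (shiftCfg_liftBL_self i hlev ψ μ) w
  rw [periodic_eq_at_chart i hperL x, liftL_apply, QT_torusLam_eq, ← siteAt_eq]
  exact QprimeT_liftBL_at_box i hlev U ψ (siteAt i x)

/-- ★★★ **(E4) READ ON def-Y's CARRIER**: for a LEVEL-PERIODIC family `μ` (period `N₀∕Lʲ` at every level `j ≤ n` — the hypothesis of `LettersAtPer`'s laws),
`QT L n (torusLam n) U₀ μ (x) = (L^{−(d+1)})ⁿ · liftL (Q′*(U; parKnitY) (descBL μ)) (x)` at EVERY `x ∈ ℤ^{d+1}` (constant level `n`; only `μ_n` is read,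
[B8] (1.5)–(1.6)). [cite: Balaban1985RegularSpaces, (1.29) p.81, (1.5)–(1.6) p.77, p.77 («Ω_j = T_η»); Balaban1985BackgroundPropagators, (3.24)–(3.25) pp.394–395] -/
theorem QT_eq_liftL_QpsY (hlev : ∀ z : SiteY i, levY i z = n) (U : CfgY 𝔸 i) {μ : ℕ → LSite (d + 1) → 𝔸}
    (hμ : ∀ j, j ≤ n → ∀ (y : LSite (d + 1)) (ν : Fin (d + 1)),
      μ j (y + ((((PV d ℓ i.m i.K hd hL).sitesPerDir 0 : ℕ) : ℤ) / (((ℓ + 1 : ℕ) : ℤ)) ^ j) • e ν) = μ j y) (x : LSite (d + 1)) :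
    QT (ℓ + 1) n (torusLam n) (liftCfg U) μ x
      = (((((ℓ + 1 : ℕ) : ℝ)) ^ (d + 1))⁻¹) ^ n • liftL i (QpsY i (parKnitY i) U (descBL i μ)) x := by
  have hμn : liftBL i n (descBL i μ) n = μ n := liftBL_descBL_self i hlev (hμ n le_rfl)
  rw [← QT_liftBL i hlev U (descBL i μ) x, QT_torusLam_eq, QT_torusLam_eq, hμn]

end Dictionaries

end Literature.MathematicalPhysics.QuantumFieldTheory.Balaban1983to89.B9B8KnitLetterTransfer

end
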